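import Summits.RiemannHypothesis.RiemannHypothesis.Theorems.SemilocalNegCertUptoSixtyOne
import HarnessLib

/-!
# Semi-local threshold of the `{∞} ∪ {p < 67}` form, negative side (theorems): `a*({2,…,61}) ≤ 545/256` (the wall `q = 67`)

Cell `rh-explicit` (HOME `run/shared/lean/pub/rh-explicit/`), seat cc-s2-4 gen8 (A4-EXT item (1): theorem upper ends for the walls
`q = 53 … 73`; `S = S_67 = {2, 3, 5, 7, 11, 13, 17, 19, 23, 29, 31, 37, 41, 43, 47, 53, 59, 61}`, class `2, …, 61 ∈ S ∌ 67`).  Honest framing: theorems about the tree's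
`weilSemilocalThreshold S`; nothing here bears on RH.  THIS FILE reads the theorems off the kernel facts of `SemilocalNegCertUptoSixtyOne.lean` (atom table,
certificate `certUptoSixtyOne`, 14 `decide +kernel` facts).

Instance data: window `N = 70` (`2b < log 71`), atoms = the `S`-smooth prime powers `≤ 70`:
`2, 3, 4, 5, 7, 8, 9, 11, 13, 16, 17, 19, 23, 25, 27, 29, 31, 32, 37, 41, 43, 47, 49, 53, 59, 61, 64` (enclosures `SemilocalLogAtoms{,B,C,D,E}.lean`).  Witness: bottom vector of the odd Legendre
section `d = 13` at `b = 545/256` from this seat's exact-kappa finder (`polyfind.py`, HOME/cc-s2-4/gen7/): `Re Q_S(G)/‖G‖² =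
−3.2086·10⁻⁴ (form without the polar credit)` ⇒ **`weilSemilocalThreshold {2, 3, 5, 7, 11, 13, 17, 19, 23, 29, 31, 37, 41, 43, 47, 53, 59, 61} ≤ 545/256`**.  The window sits just beyond the KNEE of the wall
(`b ≈ a*(S_67) + 0.01`: past it the finite-degree sections turn strongly negative and degree 13 suffices; closer to `a*`
the same witness class needs degree ≥ 25 — gen7, CC4-LEAN §12.5; knee table CC4-LEAN §13).  Locality (`N = 70`): **`a*(S) = a*(S_67) ∈
[0.8046, 545/256]` for every finite `S ⊇ S_67` with `67 ∉ S`** (DATA: a*(S_67) ∈ (2.102369, 2.102375] (cc6, N = 400)).  Folklore throughout.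
-/

set_option autoImplicit false
set_option linter.dupNamespace false  -- the mandated namespace repeats `RiemannHypothesis`

noncomputable section

open Complex Filter Set MeasureTheory Topology
open scoped Real

namespace Summit.RiemannHypothesis.RiemannHypothesis.Theorems.SemilocalPolyWitness

open MeasureTheory Set Finset Real
open Literature.NumberTheory.LFunctions
open Summit.RiemannHypothesis.RiemannHypothesis.Theorems.MotivicDoor
open Summit.RiemannHypothesis.RiemannHypothesis.Theorems.MotivicDoor.SemilocalThreshold
open Summit.RiemannHypothesis.RiemannHypothesis.Theorems.MotivicDoor.SemilocalMarkov
open LQ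

/-! ### The theorems -/

/-- **`a*({2,…,61}) ≤ 545/256`.** -/
theorem weilSemilocalThreshold_uptoSixtyOne_le :
    weilSemilocalThreshold {2, 3, 5, 7, 11, 13, 17, 19, 23, 29, 31, 37, 41, 43, 47, 53, 59, 61} ≤ ((545 / 256 : ℚ) : ℝ) :=
  weilSemilocalThreshold_le_of_checkW_sharp certUptoSixtyOne atomsEnclose_UptoSixtyOne
    check_UptoSixtyOne_main check_UptoSixtyOne_atoms check_UptoSixtyOne_pieces

/-- Failure form: positivity of the `{∞} ∪ S_67` form fails on every cone `C(B)`, `B > 545/256`. -/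
theorem not_weilSemilocalPositivityOn_uptoSixtyOne_of_gt {B : ℝ} (hB : (545 / 256 : ℝ) < B) :
    ¬ WeilSemilocalPositivityOn {2, 3, 5, 7, 11, 13, 17, 19, 23, 29, 31, 37, 41, 43, 47, 53, 59, 61} B := by
  rw [not_weilSemilocalPositivityOn_iff_weilSemilocalThreshold_lt]
  have h := weilSemilocalThreshold_uptoSixtyOne_le
  push_cast at h
  linarith

/-- `a*({2,…,61}) < (log 71)/2`: below the window of the next index. -/
theorem weilSemilocalThreshold_uptoSixtyOne_lt_log_seventyone_half :
    weilSemilocalThreshold {2, 3, 5, 7, 11, 13, 17, 19, 23, 29, 31, 37, 41, 43, 47, 53, 59, 61} < Real.log 71 / 2 := by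
  have h := weilSemilocalThreshold_uptoSixtyOne_le
  have hsucc := log_seventyone_gt
  push_cast at h
  linarith

/-- **The class `2, …, 61 ∈ S ∌ 67`**: `a*(S) = a*({2,…,61})` (locality at `N = 70`). -/
theorem weilSemilocalThreshold_eq_uptoSixtyOne {S : Finset ℕ} (h2 : 2 ∈ S) (h3 : 3 ∈ S) (h5 : 5 ∈ S) (h7 : 7 ∈ S) (h11 : 11 ∈ S) (h13 : 13 ∈ S) (h17 : 17 ∈ S) (h19 : 19 ∈ S) (h23 : 23 ∈ S) (h29 : 29 ∈ S) (h31 : 31 ∈ S) (h37 : 37 ∈ S) (h41 : 41 ∈ S) (h43 : 43 ∈ S) (h47 : 47 ∈ S) (h53 : 53 ∈ S) (h59 : 59 ∈ S) (h61 : 61 ∈ S)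
    (h67 : 67 ∉ S) : weilSemilocalThreshold S = weilSemilocalThreshold {2, 3, 5, 7, 11, 13, 17, 19, 23, 29, 31, 37, 41, 43, 47, 53, 59, 61} := by
  refine weilSemilocalThreshold_congr (S := {2, 3, 5, 7, 11, 13, 17, 19, 23, 29, 31, 37, 41, 43, 47, 53, 59, 61}) (S' := S) (N := 70) ?_ ?_
  · intro n hn hpp
    interval_cases n
    · exact absurd hpp (by decide)
    · exact absurd hpp (by decide)
    · rw [Nat.prime_two.primeFactors]; simp [h2]
    · rw [Nat.prime_three.primeFactors]; simp [h3]
    · rw [show (4 : ℕ) = 2 ^ 2 by norm_num, Nat.primeFactors_prime_pow two_ne_zero Nat.prime_two]; simp [h2]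
    · rw [(by norm_num : Nat.Prime 5).primeFactors]; simp [h5]
    · exact absurd hpp (by decide)
    · rw [(by norm_num : Nat.Prime 7).primeFactors]; simp [h7]
    · rw [show (8 : ℕ) = 2 ^ 3 by norm_num, Nat.primeFactors_prime_pow (by norm_num) Nat.prime_two]; simp [h2]
    · rw [show (9 : ℕ) = 3 ^ 2 by norm_num, Nat.primeFactors_prime_pow two_ne_zero Nat.prime_three]; simp [h3]
    · exact absurd hpp (by decide)
    · rw [(by norm_num : Nat.Prime 11).primeFactors]; simp [h11]
    · exact absurd hpp (by decide)
    · rw [(by norm_num : Nat.Prime 13).primeFactors]; simp [h13]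
    · exact absurd hpp (by decide)
    · exact absurd hpp (not_isPrimePow_of_two_primes_dvd Nat.prime_three (by norm_num : Nat.Prime 5) (by norm_num)
        (by norm_num) (by norm_num))
    · rw [show (16 : ℕ) = 2 ^ 4 by norm_num, Nat.primeFactors_prime_pow (by norm_num) Nat.prime_two]; simp [h2]
    · rw [(by norm_num : Nat.Prime 17).primeFactors]; simp [h17]
    · exact absurd hpp (by decide)
    · rw [(by norm_num : Nat.Prime 19).primeFactors]; simp [h19]
    · exact absurd hpp (by decide)
    · exact absurd hpp (not_isPrimePow_of_two_primes_dvd Nat.prime_three (by norm_num : Nat.Prime 7) (by norm_num)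
        (by norm_num) (by norm_num))
    · exact absurd hpp (by decide)
    · rw [(by norm_num : Nat.Prime 23).primeFactors]; simp [h23]
    · exact absurd hpp (by decide)
    · rw [show (25 : ℕ) = 5 ^ 2 by norm_num, Nat.primeFactors_prime_pow two_ne_zero (by norm_num : Nat.Prime 5)]; simp [h5]
    · exact absurd hpp (by decide)
    · rw [show (27 : ℕ) = 3 ^ 3 by norm_num, Nat.primeFactors_prime_pow (by norm_num) Nat.prime_three]; simp [h3]
    · exact absurd hpp (by decide)
    · rw [(by norm_num : Nat.Prime 29).primeFactors]; simp [h29]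
    · exact absurd hpp (by decide)
    · rw [(by norm_num : Nat.Prime 31).primeFactors]; simp [h31]
    · rw [show (32 : ℕ) = 2 ^ 5 by norm_num, Nat.primeFactors_prime_pow (by norm_num) Nat.prime_two]; simp [h2]
    · exact absurd hpp (not_isPrimePow_of_two_primes_dvd Nat.prime_three (by norm_num : Nat.Prime 11) (by norm_num)
        (by norm_num) (by norm_num))
    · exact absurd hpp (by decide)
    · exact absurd hpp (not_isPrimePow_of_two_primes_dvd (by norm_num : Nat.Prime 5) (by norm_num : Nat.Prime 7) (by norm_num)
        (by norm_num) (by norm_num))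
    · exact absurd hpp (by decide)
    · rw [(by norm_num : Nat.Prime 37).primeFactors]; simp [h37]
    · exact absurd hpp (by decide)
    · exact absurd hpp (not_isPrimePow_of_two_primes_dvd Nat.prime_three (by norm_num : Nat.Prime 13) (by norm_num)
        (by norm_num) (by norm_num))
    · exact absurd hpp (by decide)
    · rw [(by norm_num : Nat.Prime 41).primeFactors]; simp [h41]
    · exact absurd hpp (by decide)
    · rw [(by norm_num : Nat.Prime 43).primeFactors]; simp [h43]
    · exact absurd hpp (by decide)
    · exact absurd hpp (not_isPrimePow_of_two_primes_dvd Nat.prime_three (by norm_num : Nat.Prime 5) (by norm_num)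
        (by norm_num) (by norm_num))
    · exact absurd hpp (by decide)
    · rw [(by norm_num : Nat.Prime 47).primeFactors]; simp [h47]
    · exact absurd hpp (by decide)
    · rw [show (49 : ℕ) = 7 ^ 2 by norm_num, Nat.primeFactors_prime_pow two_ne_zero (by norm_num : Nat.Prime 7)]; simp [h7]
    · exact absurd hpp (by decide)
    · exact absurd hpp (not_isPrimePow_of_two_primes_dvd Nat.prime_three (by norm_num : Nat.Prime 17) (by norm_num)
        (by norm_num) (by norm_num))
    · exact absurd hpp (by decide)
    · rw [(by norm_num : Nat.Prime 53).primeFactors]; simp [h53]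
    · exact absurd hpp (by decide)
    · exact absurd hpp (not_isPrimePow_of_two_primes_dvd (by norm_num : Nat.Prime 5) (by norm_num : Nat.Prime 11) (by norm_num)
        (by norm_num) (by norm_num))
    · exact absurd hpp (by decide)
    · exact absurd hpp (not_isPrimePow_of_two_primes_dvd Nat.prime_three (by norm_num : Nat.Prime 19) (by norm_num)
        (by norm_num) (by norm_num))
    · exact absurd hpp (by decide)
    · rw [(by norm_num : Nat.Prime 59).primeFactors]; simp [h59]
    · exact absurd hpp (by decide)
    · rw [(by norm_num : Nat.Prime 61).primeFactors]; simp [h61]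
    · exact absurd hpp (by decide)
    · exact absurd hpp (not_isPrimePow_of_two_primes_dvd Nat.prime_three (by norm_num : Nat.Prime 7) (by norm_num)
        (by norm_num) (by norm_num))
    · rw [show (64 : ℕ) = 2 ^ 6 by norm_num, Nat.primeFactors_prime_pow (by norm_num) Nat.prime_two]; simp [h2]
    · exact absurd hpp (not_isPrimePow_of_two_primes_dvd (by norm_num : Nat.Prime 5) (by norm_num : Nat.Prime 13) (by norm_num)
        (by norm_num) (by norm_num))
    · exact absurd hpp (by decide)
    · rw [(by norm_num : Nat.Prime 67).primeFactors]; simp [h67]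
    · exact absurd hpp (by decide)
    · exact absurd hpp (not_isPrimePow_of_two_primes_dvd Nat.prime_three (by norm_num : Nat.Prime 23) (by norm_num)
        (by norm_num) (by norm_num))
    · exact absurd hpp (by decide)
  · have h := weilSemilocalThreshold_uptoSixtyOne_lt_log_seventyone_half
    norm_num
    exact h

/-- **`a*(S) ≤ 545/256` for every finite set of primes `S` with `2, …, 61 ∈ S`, `67 ∉ S`.** -/
theorem weilSemilocalThreshold_le_of_mem_sixtyone {S : Finset ℕ} (h2 : 2 ∈ S) (h3 : 3 ∈ S) (h5 : 5 ∈ S) (h7 : 7 ∈ S) (h11 : 11 ∈ S) (h13 : 13 ∈ S) (h17 : 17 ∈ S) (h19 : 19 ∈ S) (h23 : 23 ∈ S) (h29 : 29 ∈ S) (h31 : 31 ∈ S) (h37 : 37 ∈ S) (h41 : 41 ∈ S) (h43 : 43 ∈ S) (h47 : 47 ∈ S) (h53 : 53 ∈ S) (h59 : 59 ∈ S) (h61 : 61 ∈ S)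
    (h67 : 67 ∉ S) : weilSemilocalThreshold S ≤ ((545 / 256 : ℚ) : ℝ) := by
  rw [weilSemilocalThreshold_eq_uptoSixtyOne h2 h3 h5 h7 h11 h13 h17 h19 h23 h29 h31 h37 h41 h43 h47 h53 h59 h61 h67]
  exact weilSemilocalThreshold_uptoSixtyOne_le

/-- **The bracket of the class `2, …, 61 ∈ S ∌ 67`**: `4023/5000 ≤ a*(S) ≤ 545/256` (DATA `a*(S_67) ≈ 2.102375`). -/
theorem weilSemilocalThreshold_mem_Icc_of_mem_sixtyone {S : Finset ℕ} (h2 : 2 ∈ S) (h3 : 3 ∈ S) (h5 : 5 ∈ S) (h7 : 7 ∈ S) (h11 : 11 ∈ S) (h13 : 13 ∈ S) (h17 : 17 ∈ S) (h19 : 19 ∈ S) (h23 : 23 ∈ S) (h29 : 29 ∈ S) (h31 : 31 ∈ S) (h37 : 37 ∈ S) (h41 : 41 ∈ S) (h43 : 43 ∈ S) (h47 : 47 ∈ S) (h53 : 53 ∈ S) (h59 : 59 ∈ S) (h61 : 61 ∈ S)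
    (h67 : 67 ∉ S) : weilSemilocalThreshold S ∈ Set.Icc (4023 / 5000 : ℝ) ((545 / 256 : ℚ) : ℝ) :=
  ⟨SemilocalTwoThree.le_weilSemilocalThreshold_of_two_three_8046 h2 h3,
    weilSemilocalThreshold_le_of_mem_sixtyone h2 h3 h5 h7 h11 h13 h17 h19 h23 h29 h31 h37 h41 h43 h47 h53 h59 h61 h67⟩

end Summit.RiemannHypothesis.RiemannHypothesis.Theorems.SemilocalPolyWitness

end

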